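import Literature.MathematicalPhysics.KineticTheory.LangevinChainSmallSets
import Literature.MathematicalPhysics.KineticTheory.LangevinChainReach
import HarnessLib

/-!
# The pinned chain: CEHR Prop. 3.6 and Theorem 2.13 from transition densities alone

Trunk T-KINETIC (Literature/MathematicalPhysics/KineticTheory). Provefact unit for the named fact
`CuneoEckmannHairerReyBellet2018_thm213` (`LangevinSemigroup.lean`), continued from
`LangevinChainSmallSets.lean`. There, Cuneo–Eckmann–Hairer–Rey-Bellet 2018, Prop. 3.6 (every
compact set is small for all large times) was derived for the constructed transition semigroup
of the pinned chain from TWO printed inputs taken as hypotheses: Prop. 3.2 (jointly continuous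
transition densities, `h32`) and Prop. 3.3 (irreducibility, `h33`). Here the irreducibility
hypothesis is REMOVED: the abstract small-set theorem needs irreducibility only towards the
neighbourhoods of the base point of the local small set
(`Literature.Probability.Process.MarkovSemigroup.exists_smul_restrict_le_of_isCompact_of_mem`),
we place that base point at the equilibrium `0`, and every point reaches every neighbourhood of
`0` with positive probability (`pinnedChain_exists_transitionKernel_pos_of_zero_mem`,
`LangevinChainReach.lean`: LaSalle for the undriven damped chain + continuity in the noise + small
balls of Wiener measure).

* `pinnedChain_minorization_of_localSmall` — PROVED: ONE local minorisation near the equilibrium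
  (open `G₀ ∋ 0`, `P_t(w,·) ≥ η·Leb|_{U₀}` for `w ∈ G₀`, `t` in a window) ⟹ Prop. 3.6 for the
  pinned chain; `pinnedChain_minorization_of_density` — PROVED: Prop. 3.2 (continuous densities) ⟹
  Prop. 3.6.
* `CuneoEckmannHairerReyBellet2018_thm213_of_H2_of_localSmall_of_hormander` — PROVED: Theorem
  2.13 from H2, Hörmander Thm 1.1 and one local minorisation near the equilibrium.
* `CuneoEckmannHairerReyBellet2018_thm213_of_H2_of_density_of_hormander` — PROVED: Theorem 2.13
  for the pinned chain from the named facts H2 (CEHR Thm 5.1 / Rem 5.2) and Hörmander 1967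
  Thm 1.1, and the single remaining printed statement of CEHR Prop. 3.2 (hypothesis `h32`:
  "the transition kernel (2.3) can be written as `P_t(z, dz') = p_t(z, z') dz'`, where the map
  `(t, z, z') ↦ p_t(z, z')` is smooth on `(0,∞) × Ω × Ω`" — used through continuity only).

## References

* N. Cuneo, J.-P. Eckmann, M. Hairer, L. Rey-Bellet, *Non-equilibrium steady states for networks
  of oscillators*, Electron. J. Probab. 23 (2018) no. 55 (arXiv:1712.09413): Props. 3.2, 3.3, 3.6,
  Thm 2.13.
-/

noncomputable section

open MeasureTheory ProbabilityTheory Filter Topology Set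
open scoped NNReal ENNReal BoundedContinuousFunction

namespace Literature.MathematicalPhysics.KineticTheory.HeatConduction

open Literature.Probability.Process OscillatorChain

variable {N : ℕ}

section Pinned

variable {ω₂ lam β γ : ℝ} (hω : 0 < ω₂) (hl : 0 ≤ lam) (hβ : 0 < β) (hγ : 0 < γ)
  (hN : 0 < N) {T_L T_R : ℝ} (hL : 0 < T_L) (hR : 0 < T_R)
include hω hl hβ hγ hN hL hR

/-- **CEHR Prop. 3.6 for the pinned chain from ONE local minorisation near the equilibrium.**
If for some open `G₀ ∋ 0`, some nonempty open `U₀`, some `η > 0` and some time window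
`[t₀ - δ, t₀ + δ]` (`0 < δ ≤ t₀`) the transition kernels satisfy `P_t(w, ·) ≥ η · Leb|_{U₀}` for
all `w ∈ G₀` and `t` in the window (a "local small set" at the origin — the first step of the
printed proof of Prop. 3.6, there obtained from continuous densities), then EVERY compact set is
small for all large times: for every compact `C` there is `t_C` such that for all `t ≥ t_C` some
nonzero measure `ν` satisfies `ν ≤ P_t(z, ·)` for all `z ∈ C`. The remaining inputs of the printed
proof are supplied: the semigroup is Feller (`continuous_act_pinnedChainSemigroup`) and every
point reaches every neighbourhood of the equilibrium with positive probability
(`pinnedChain_exists_transitionKernel_pos_of_zero_mem`), which is all the pointed small-set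
theorem `exists_smul_le_of_isCompact_of_mem` requires.
[cite: CuneoEckmannHairerReyBellet2018, Prop 3.6] -/
theorem pinnedChain_minorization_of_localSmall
    (hloc : ∃ (G₀ U₀ : Set (PhaseSpace N)) (η : ℝ≥0∞) (t₀ δ : ℝ), IsOpen G₀ ∧ (0 : PhaseSpace N) ∈ G₀ ∧
      IsOpen U₀ ∧ U₀.Nonempty ∧ 0 < η ∧ 0 < δ ∧ δ ≤ t₀ ∧
      ∀ t : ℝ≥0, t₀ - δ ≤ (t : ℝ) → (t : ℝ) ≤ t₀ + δ → ∀ w ∈ G₀,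
        η • (volume : Measure (PhaseSpace N)).restrict U₀ ≤
          (pinnedChain ω₂ lam β γ).transitionKernel N T_L T_R t w) :
    ∀ C : Set (PhaseSpace N), IsCompact C → ∃ t_C : ℝ≥0, ∀ t : ℝ≥0, t_C ≤ t →
      ∃ ν : Measure (PhaseSpace N), ν ≠ 0 ∧
        ∀ z ∈ C, ν ≤ (pinnedChain ω₂ lam β γ).transitionKernel N T_L T_R t z := by
  set S := pinnedChainSemigroup hω hl hβ.le hγ.le hN hL.le hR.le with hS
  obtain ⟨G₀, U₀, η, t₀, δ, hG₀, h0, hU₀, ⟨y₀, hy₀⟩, hη, hδ, hδt, hmin⟩ := hloc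
  have hF : ∀ (t : ℝ≥0) (g : PhaseSpace N →ᵇ ℝ), Continuous fun x => ∫ y, g y ∂(S.kernel t x) :=
    continuous_act_pinnedChainSemigroup hω hl hβ.le hγ.le hN hL.le hR.le
  have h33' : ∀ (z : PhaseSpace N) (U : Set (PhaseSpace N)), IsOpen U → (0 : PhaseSpace N) ∈ U →
      ∃ t : ℝ≥0, 0 < S.kernel t z U := fun z U hU h0U =>
    pinnedChain_exists_transitionKernel_pos_of_zero_mem hω hl hβ.le hγ hN T_L T_R z U hU h0U
  have hmin' : ∀ t : ℝ≥0, t₀ - δ ≤ (t : ℝ) → (t : ℝ) ≤ t₀ + δ → ∀ w ∈ G₀,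
      η • (volume : Measure (PhaseSpace N)).restrict U₀ ≤ S.kernel t w := hmin
  -- `ν₀ = η • λ|_{U₀}` charges every neighbourhood of `y₀`
  have hν₀ : ∀ V : Set (PhaseSpace N), IsOpen V → y₀ ∈ V →
      0 < (η • (volume : Measure (PhaseSpace N)).restrict U₀) V := by
    intro V hV hyV
    rw [Measure.smul_apply, Measure.restrict_apply hV.measurableSet, smul_eq_mul]
    exact ENNReal.mul_pos hη.ne' ((hV.inter hU₀).measure_pos volume ⟨y₀, hyV, hy₀⟩).ne'
  intro C hC
  obtain ⟨t_C, ht_C⟩ := MarkovSemigroup.exists_smul_le_of_isCompact_of_mem S.kernel S.kernel_add hF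
    h33' hG₀ h0 hν₀ hδ hδt hmin' hC
  refine ⟨t_C, fun t ht => ?_⟩
  obtain ⟨ε, hε, -, hle⟩ := ht_C t ht
  refine ⟨ε • (η • (volume : Measure (PhaseSpace N)).restrict U₀), ?_, hle⟩
  intro hz
  have h1 : (ε • (η • (volume : Measure (PhaseSpace N)).restrict U₀)) U₀ = 0 := by
    rw [hz, Measure.coe_zero, Pi.zero_apply]
  rw [Measure.smul_apply, smul_eq_mul] at h1
  exact (ENNReal.mul_pos hε.ne' (hν₀ U₀ hU₀ hy₀).ne').ne' h1

/-- **CEHR Prop. 3.6 for the pinned chain from Prop. 3.2 (continuous transition densities)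
alone.** If the transition kernels `P_t(z, ·)` of the pinned chain have, for `t > 0`, densities
`p_t(z, ·)` with respect to Lebesgue measure with `(t, z, z') ↦ p_t(z, z')` continuous on
`(0, ∞) × Ω × Ω`, then for every compact `C` there is `t_C` such that for all `t ≥ t_C` some
nonzero measure `ν` satisfies `ν ≤ P_t(z, ·)` for all `z ∈ C`: a continuous density gives a local
small set at the origin (`exists_local_small_of_density`), and
`pinnedChain_minorization_of_localSmall` applies. [cite: CuneoEckmannHairerReyBellet2018, Prop 3.6] -/
theorem pinnedChain_minorization_of_density
    (h32 : ∃ p : ℝ≥0 → PhaseSpace N → PhaseSpace N → ℝ≥0,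
      ContinuousOn (fun q : ℝ≥0 × PhaseSpace N × PhaseSpace N => p q.1 q.2.1 q.2.2) {q | 0 < q.1} ∧
      ∀ t : ℝ≥0, 0 < t → ∀ z : PhaseSpace N,
        (pinnedChain ω₂ lam β γ).transitionKernel N T_L T_R t z =
          (volume : Measure (PhaseSpace N)).withDensity fun y => p t z y) :
    ∀ C : Set (PhaseSpace N), IsCompact C → ∃ t_C : ℝ≥0, ∀ t : ℝ≥0, t_C ≤ t →
      ∃ ν : Measure (PhaseSpace N), ν ≠ 0 ∧
        ∀ z ∈ C, ν ≤ (pinnedChain ω₂ lam β γ).transitionKernel N T_L T_R t z := by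
  obtain ⟨p, hp, hdens⟩ := h32
  haveI : ∀ t, IsMarkovKernel ((pinnedChain ω₂ lam β γ).transitionKernel N T_L T_R t) := fun t =>
    pinnedChain_isMarkovKernel_transitionKernel hω hl hβ.le hγ.le N T_L T_R t
  obtain ⟨y₀, G₀, U₀, η, δ, hG₀, hz₀, hU₀, hy₀, hη, hδ, hδt, hloc⟩ :=
    MarkovSemigroup.exists_local_small_of_density
      (fun t => (pinnedChain ω₂ lam β γ).transitionKernel N T_L T_R t) p hp hdens one_pos
      (0 : PhaseSpace N)
  refine pinnedChain_minorization_of_localSmall hω hl hβ hγ hN hL hR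
    ⟨G₀, U₀, η, ((1 : ℝ≥0) : ℝ), δ, hG₀, hz₀, hU₀, ⟨y₀, hy₀⟩, hη, hδ, by exact_mod_cast hδt, ?_⟩
  intro t ht1 ht2 w hw
  exact hloc t (by exact_mod_cast ht1) (by exact_mod_cast ht2) w hw

end Pinned

/-- **Cuneo–Eckmann–Hairer–Rey-Bellet 2018, Theorem 2.13 for the pinned chain, from the named
facts H2 (CEHR Thm 5.1 / Rem 5.2) and Hörmander 1967 Thm 1.1, and ONE local minorisation of the
transition kernels near the equilibrium** (hypothesis `hloc`: for every admissible parameter set,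
some open `G₀ ∋ 0`, nonempty open `U₀`, `η > 0` and time window `[t₀ - δ, t₀ + δ]` with
`P_t(w, ·) ≥ η · Leb|_{U₀}` for `w ∈ G₀` and `t` in the window — the first step of the printed
proof of Prop. 3.6). Everything else in CEHR §3 is proved for the constructed semigroup:
Krylov–Bogoliubov existence, the pointed irreducibility, Prop. 3.6
(`pinnedChain_minorization_of_localSmall`), Harris' theorem and (2.5)
(`CuneoEckmannHairerReyBellet2018_thm213_of_H2_of_minorization_of_hormander`).
[cite: CuneoEckmannHairerReyBellet2018, Thm 2.13] -/
theorem CuneoEckmannHairerReyBellet2018_thm213_of_H2_of_localSmall_of_hormander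
    (h2 : CuneoEckmannHairerReyBellet2018_H2)
    (hloc : ∀ ω₂ lam β γ : ℝ, 0 < ω₂ → 0 ≤ lam → 0 < β → 0 < γ →
      ∀ (N : ℕ) (T_L T_R : ℝ), 0 < N → 0 < T_L → 0 < T_R →
        ∃ (G₀ U₀ : Set (PhaseSpace N)) (η : ℝ≥0∞) (t₀ δ : ℝ), IsOpen G₀ ∧ (0 : PhaseSpace N) ∈ G₀ ∧
          IsOpen U₀ ∧ U₀.Nonempty ∧ 0 < η ∧ 0 < δ ∧ δ ≤ t₀ ∧
          ∀ t : ℝ≥0, t₀ - δ ≤ (t : ℝ) → (t : ℝ) ≤ t₀ + δ → ∀ w ∈ G₀,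
            η • (volume : Measure (PhaseSpace N)).restrict U₀ ≤
              (pinnedChain ω₂ lam β γ).transitionKernel N T_L T_R t w)
    (hH : Literature.Analysis.Distribution.Hormander1967_thm11) :
    CuneoEckmannHairerReyBellet2018_thm213 :=
  CuneoEckmannHairerReyBellet2018_thm213_of_H2_of_minorization_of_hormander h2
    (fun ω₂ lam β γ hω hl hβ hγ N T_L T_R hN hL hR =>
      pinnedChain_minorization_of_localSmall hω hl hβ hγ hN hL hR
        (hloc ω₂ lam β γ hω hl hβ hγ N T_L T_R hN hL hR)) hH

/-- **Cuneo–Eckmann–Hairer–Rey-Bellet 2018, Theorem 2.13 for the pinned chain, from the named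
facts H2 (CEHR Thm 5.1 / Rem 5.2) and Hörmander 1967 Thm 1.1, and the printed statement of
CEHR Prop. 3.2 (continuous transition densities, hypothesis `h32`) for the transition kernels of
the pinned chain** — the irreducibility of CEHR Prop. 3.3 being PROVED in the pointed form the
argument needs (`LangevinChainReach.lean`). Combines `pinnedChain_minorization_of_density`
(Prop. 3.6) with `CuneoEckmannHairerReyBellet2018_thm213_of_H2_of_minorization_of_hormander`.
[cite: CuneoEckmannHairerReyBellet2018, Thm 2.13] -/
theorem CuneoEckmannHairerReyBellet2018_thm213_of_H2_of_density_of_hormander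
    (h2 : CuneoEckmannHairerReyBellet2018_H2)
    (h32 : ∀ ω₂ lam β γ : ℝ, 0 < ω₂ → 0 ≤ lam → 0 < β → 0 < γ →
      ∀ (N : ℕ) (T_L T_R : ℝ), 0 < N → 0 < T_L → 0 < T_R →
        ∃ p : ℝ≥0 → PhaseSpace N → PhaseSpace N → ℝ≥0,
          ContinuousOn (fun q : ℝ≥0 × PhaseSpace N × PhaseSpace N => p q.1 q.2.1 q.2.2)
            {q | 0 < q.1} ∧
          ∀ t : ℝ≥0, 0 < t → ∀ z : PhaseSpace N,
            (pinnedChain ω₂ lam β γ).transitionKernel N T_L T_R t z =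
              (volume : Measure (PhaseSpace N)).withDensity fun y => p t z y)
    (hH : Literature.Analysis.Distribution.Hormander1967_thm11) :
    CuneoEckmannHairerReyBellet2018_thm213 :=
  CuneoEckmannHairerReyBellet2018_thm213_of_H2_of_minorization_of_hormander h2
    (fun ω₂ lam β γ hω hl hβ hγ N T_L T_R hN hL hR =>
      pinnedChain_minorization_of_density hω hl hβ hγ hN hL hR
        (h32 ω₂ lam β γ hω hl hβ hγ N T_L T_R hN hL hR)) hH

end Literature.MathematicalPhysics.KineticTheory.HeatConduction
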